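import Summits.QuantumFields.YangMills.Theorems.SmallFieldWideningAllHeightsSmallTiltOfSandwich
import Summits.QuantumFields.YangMills.Theorems.UnitScaleTiltFluctuationComparisonRegPrOneStepSubmersion
import Summits.QuantumFields.YangMills.Theorems.UnitScaleTiltFluctuationComparisonRegPrAnsatzTStub
import Summits.QuantumFields.YangMills.Theorems.AlphaInputsT3ACEnvelope
import HarnessLib

/-!
# Route `SmallFieldWidening` — crux r2 `AllHeightsSmallTilt` (stmt-QuantumFields-22883): THE NON-DEGENERACY OF THE ALL-HEIGHTS
# COMPARISON, PROVED, and «registered stub ⟺ crux» (support file; width seat `ym-line-sfw-p2-w3` gen 2 of line `ym-line-sfw-p2`)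

The crux r2 (`UnitTiltAt F γ b₀ p₀ 0`: EVERY height of both runs constrained) compares, for every `K`, the constrained unit laws
`(A_K)_*(Gibbs_K|histGood K 0)` and `(A_{K+1})_*(Gibbs_{K+1}|histGood (K+1) 0)`; its registered stub (`stub_smallDataSandwich`) is the a.e.
two-sided sandwich, modulo constants, of their Radon–Nikodym derivatives (`= Z⁻¹·heightDensity`, p588259).  A tilt `ν = C·e^{h}·μ` with `C > 0`
forces mutual absolute continuity, so the comparison can only make sense if both constrained densities CHARGE THE SAME REGION.  This file
proves that they do — unconditionally, in the small-coupling regime the route uses — by instantiating the landed «Lemma B» line of route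
`UnitScaleTilt`'s K1 at `n = 0` free top steps (the tree states it for `⌊K/m⌋`, `0 < m` only):

* §1 **`heightDensity_histGood_pos_ae`** — for every block size `L` and profile `(b₀ > 0, p₀ > 2)` there is `0 < γ₁ ≤ 1` such that for every
  family with `F.L = L`, every `0 < γ ≤ γ₁`, EVERY number `n` of free top steps and every run `K ≥ n`, the restricted height density
  `heightDensity F γ _ (histGood F ℰp θBal K n)` is positive for a.e. datum of the `n`-th comparison lattice in the window `PlaqSmall θBal(n)`.
  Proof: `OneStepSubmersion.fibrePositivityBelow` (one-step submersion of the printed (0.4) averaging ⇒ «Lemma B» below a radius) +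
  `T3SmallLiftHistory.exists_mem_fibre_histGood` (every small datum has a UV-small history, from the landed one-step small lift
  `ApproxLift.AnsatzT.stub_oneStepSmallLift`) + `T3Thresholds.exists_gamma_forall_θBal_le` (shrink `γ₁` until every threshold is below the radii).
  The case `n = 0` is the one r2 needs: both FULLY-CONSTRAINED densities are a.e. positive on the unit-lattice window `PlaqSmall θBal(0)`.
* §2 **`gibbsK_histGood_pos`** — consequently the all-heights UV-small-history events have POSITIVE Gibbs mass and the constrained unit laws
  are non-zero (the window has positive product-Haar measure, `fieldMeasure_plaqSmall_pos`; the density is `Z_K⁻¹·heightDensity`, p588259).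
* §3 **`ae_sandwich_of_isTilt_withDensity`** (pure measure theory) and **`rnDeriv_sandwich_of_isTilt_unitA`** — a tilt between two
  `withDensity` measures with the second one non-zero IS an a.e. two-sided sandwich of the densities modulo a positive constant
  (`IsTilt.exists_smul_le_le_smul` + `ae_le_of_forall_setLIntegral_le_of_sigmaFinite`).
* §4 **`smallDataSandwich_of_allHeightsSmallTilt`** and **`allHeightsSmallTilt_iff_smallDataSandwich`** — with p588259's
  `allHeightsSmallTilt_of_smallDataSandwich`: THE REGISTERED STUB IS EQUIVALENT TO THE CRUX (it is r2 in the density currency; no hidden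
  strengthening, no support-mismatch escape: r2 can only fail quantitatively — an unbounded two-run log-density ratio on the window or
  non-summable radii).

WHAT THIS IS NOT: no bound on the densities (the E3 content of r2) is proved; no summit statement is touched (rung R3 record; the
Yang–Mills mass gap is not proved by this line).
-/

noncomputable section

open MeasureTheory Filter Topology
open scoped ENNReal
open Literature.MathematicalPhysics.QuantumFieldTheory
open Literature.MathematicalPhysics.QuantumFieldTheory.Balaban1983to89
open Literature.MathematicalPhysics.QuantumFieldTheory.Balaban1983to89.Missing
open Literature.MathematicalPhysics.QuantumFieldTheory.Balaban1983to89.T3ContinuumYM3Torus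
open Literature.MathematicalPhysics.QuantumFieldTheory.Balaban1983to89.T3LevelShift
open Literature.MathematicalPhysics.QuantumFieldTheory.Balaban1983to89.T3UnitScaleTilt
open Literature.MathematicalPhysics.QuantumFieldTheory.Balaban1983to89.T3UnitLawDensityEML
open Literature.MathematicalPhysics.QuantumFieldTheory.Balaban1983to89.T3TiltDescent
open Literature.MathematicalPhysics.QuantumFieldTheory.Balaban1983to89.T3CruxEstimates
open Literature.MathematicalPhysics.QuantumFieldTheory.Balaban1983to89.T3SmallLiftHistory
open Literature.MathematicalPhysics.QuantumFieldTheory.Balaban1983to89.T3Thresholds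
open Literature.MathematicalPhysics.QuantumFieldTheory.Balaban1983to89.T4Continuum

namespace Summit.QuantumFields.YangMills.Theorems.AllHeightsSmallTilt

/-! ## §1 The restricted height densities are a.e. positive on the small-field window — every number of free top steps -/

/-- **A.E. POSITIVITY OF THE RESTRICTED HEIGHT DENSITIES ON THE SMALL-FIELD WINDOW, FOR EVERY NUMBER `n` OF FREE TOP STEPS**
(in particular `n = 0`: the FULLY-CONSTRAINED unit densities of the route's crux r2).  For every `L` and profile `(b₀ > 0, p₀ > 2)`
there is `0 < γ₁ ≤ 1` such that for every three-torus family with `F.L = L`, every `0 < γ ≤ γ₁`, every `n ≤ K`: for product-Haar-a.e.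
datum `V` of the `n`-th comparison lattice with `PlaqSmall θBal(n) V`, `0 < heightDensity F γ _ (histGood F ℰp θBal K n) V`.  «Lemma B»
below a radius (`OneStepSubmersion.fibrePositivityBelow`) + every small datum has a UV-small history (`exists_mem_fibre_histGood` on
the landed `stub_oneStepSmallLift`).  Measure theory about [Balaban1985UV3] (2)/(7); nothing of Bałaban's estimates is asserted.
[cite: Balaban1985UV3, (2) p.256, (7) p.257 and (41) p.266] -/
theorem heightDensity_histGood_pos_ae :
    ∀ (L : ℕ) (b₀ p₀ : ℝ), 0 < b₀ → 2 < p₀ → ∃ γ₁ : ℝ, 0 < γ₁ ∧ γ₁ ≤ 1 ∧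
      ∀ (F : T3Family) (γ : ℝ), F.L = L → 0 < γ → γ ≤ γ₁ → ∀ (n K : ℕ) (h : n ≤ K),
        ∀ᵐ V ∂fieldMeasure (F.P n) 0 (Matrix.specialUnitaryGroup (Fin 2) ℂ),
          PlaqSmall (θBal F.L γ b₀ p₀ n) V →
            0 < heightDensity F γ h (histGood F ℰp (θBal F.L γ b₀ p₀) K n) V := by
  intro L b₀ p₀ hb hp
  obtain ⟨κ, δ₀, hκ, hδ₀, hF⟩ := ApproxLift.AnsatzT.stub_oneStepSmallLift L
  obtain ⟨δ₁, hδ₁, hP⟩ := OneStepSubmersion.fibrePositivityBelow L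
  obtain ⟨γ₁, hγ₁, hγ₁1, hθ⟩ :=
    exists_gamma_forall_θBal_le (b₀ := b₀) (p₀ := p₀) hb (by linarith) (lt_min hδ₀ hδ₁)
  refine ⟨γ₁, hγ₁, hγ₁1, fun F γ hFL hγ hγγ₁ n K h => ?_⟩
  have hL : 1 ≤ F.L := F.hL.2.le
  subst hFL
  have hγ1 : γ ≤ 1 := hγγ₁.trans hγ₁1
  have hθ₀ : ∀ i, θBal F.L γ b₀ p₀ i ≤ δ₀ := fun i => (hθ F.L hL γ hγ hγγ₁ i).trans (min_le_left _ _)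
  have hθ₁ : ∀ i, θBal F.L γ b₀ p₀ i ≤ δ₁ := fun i => (hθ F.L hL γ hγ hγγ₁ i).trans (min_le_right _ _)
  -- `κ ≤ 1` from `κ√L ≤ 1`, `L ≥ 1`
  have hκ1 : κ ≤ 1 := by
    rcases le_or_gt κ 0 with hκ0 | hκ0
    · linarith
    · have h1 : (1 : ℝ) ≤ Real.sqrt F.L := by
        rw [show (1 : ℝ) = Real.sqrt 1 from Real.sqrt_one.symm]
        exact Real.sqrt_le_sqrt (by exact_mod_cast hL)
      have h2 := mul_le_mul_of_nonneg_left h1 hκ0.le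
      rw [mul_one] at h2
      exact h2.trans hκ
  have hθpos : ∀ i, 0 < θBal F.L γ b₀ p₀ i := fun i =>
    T3MinimiserStabilityReduction.θBal_pos hL hγ hγ1 hb p₀ i
  have hθs : ∀ i, κ * θBal F.L γ b₀ p₀ i ≤ θBal F.L γ b₀ p₀ (i + 1) :=
    mul_θBal_le_θBal_succ hL hγ hγ1 hb.le (by linarith) hκ
  have hfp : FibrePositivity F γ h (histGood F ℰp (θBal F.L γ b₀ p₀) K n) := hP F rfl γ b₀ p₀ n K h hγ hθ₁
  filter_upwards [hfp] with V hV hsm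
  exact hV (exists_mem_fibre_histGood F ℰp (hF F rfl) hκ1 hθpos hθ₀ hθs h hsm)

/-! ## §2 Positive Gibbs mass of the all-heights UV-small histories; the constrained unit laws are non-zero -/

section Mass

variable (F : T3Family) {γ : ℝ} (hγ : 0 ≤ γ) (K : ℕ) (θ : ℕ → ℝ)

include hγ

/-- **THE CONSTRAINED UNIT LAW CHARGES THE WINDOW** if its density is a.e. positive there: for a measurable event `S` of run `K` and
a radius `δ > 0`, if `heightDensity F γ _ S > 0` a.e. on `{PlaqSmall δ}` then `0 < (A_K)_*(Gibbs_K|S){PlaqSmall δ}` (the window has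
positive product-Haar measure, `fieldMeasure_plaqSmall_pos`; the law is `dV.withDensity (Z_K⁻¹·heightDensity)`, p588259).
[cite: Balaban1985UV3, (2) p.256 and (6) p.257] -/
theorem map_unitA_restrict_window_pos {S : Set (GaugeField (F.P K) 0 (Matrix.specialUnitaryGroup (Fin 2) ℂ))}
    (hS : MeasurableSet S) {δ : ℝ} (hδ : 0 < δ)
    (hpos : ∀ᵐ V ∂fieldMeasure (F.P 0) 0 (Matrix.specialUnitaryGroup (Fin 2) ℂ),
      PlaqSmall δ V → 0 < heightDensity F γ (Nat.zero_le K) S V) :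
    0 < Measure.map (unitA F ℰp K) ((gibbsK F ℰp γ K).restrict S)
      {V : GaugeField (F.P 0) 0 (Matrix.specialUnitaryGroup (Fin 2) ℂ) | PlaqSmall δ V} := by
  obtain ⟨Z, hZ⟩ : ∃ Z : ℝ, Z = partitionFn (G := Matrix.specialUnitaryGroup (Fin 2) ℂ) (F.P K) ((F.scheme ℰp γ).β K) :=
    ⟨_, rfl⟩
  have hZp : 0 < Z := by rw [hZ]; exact partitionFn_pos' _ (F.scheme_β_nonneg ℰp hγ K)
  obtain ⟨f, hf⟩ : ∃ f : GaugeField (F.P 0) 0 (Matrix.specialUnitaryGroup (Fin 2) ℂ) → ℝ≥0∞,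
      f = fun V => ENNReal.ofReal (Z⁻¹ * heightDensity F γ (Nat.zero_le K) S V) := ⟨_, rfl⟩
  have hfm : Measurable f := by
    rw [hf]
    exact ((heightDensity_props F (Nat.zero_le K) hS hγ).1.const_mul _).ennreal_ofReal
  have hWpos : 0 < fieldMeasure (F.P 0) 0 (Matrix.specialUnitaryGroup (Fin 2) ℂ)
      {V : GaugeField (F.P 0) 0 (Matrix.specialUnitaryGroup (Fin 2) ℂ) | PlaqSmall δ V} :=
    fieldMeasure_plaqSmall_pos hδ
  -- the null set where the density vanishes inside the window
  have hnull : fieldMeasure (F.P 0) 0 (Matrix.specialUnitaryGroup (Fin 2) ℂ)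
      {V : GaugeField (F.P 0) 0 (Matrix.specialUnitaryGroup (Fin 2) ℂ) | PlaqSmall δ V ∧ f V = 0} = 0 := by
    rw [measure_eq_zero_iff_ae_notMem]
    filter_upwards [hpos] with V hV
    rintro ⟨hVW, hfV⟩
    have hd : 0 < Z⁻¹ * heightDensity F γ (Nat.zero_le K) S V := mul_pos (inv_pos.mpr hZp) (hV hVW)
    rw [hf] at hfV
    exact (ENNReal.ofReal_pos.mpr hd).ne' hfV
  rw [map_unitA_restrict_eq_withDensity F hγ K hS, ← hZ, ← hf]
  refine pos_iff_ne_zero.mpr fun h0 => ?_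
  rw [withDensity_apply_eq_zero hfm] at h0
  have hcover : {V : GaugeField (F.P 0) 0 (Matrix.specialUnitaryGroup (Fin 2) ℂ) | PlaqSmall δ V} ⊆
      ({V | f V ≠ 0} ∩ {V | PlaqSmall δ V}) ∪ {V | PlaqSmall δ V ∧ f V = 0} := by
    intro V hV
    by_cases hfV : f V = 0
    · exact Or.inr ⟨hV, hfV⟩
    · exact Or.inl ⟨hfV, hV⟩
  have hle := (measure_mono (μ := fieldMeasure (F.P 0) 0 (Matrix.specialUnitaryGroup (Fin 2) ℂ)) hcover).trans
    (measure_union_le (μ := fieldMeasure (F.P 0) 0 (Matrix.specialUnitaryGroup (Fin 2) ℂ)) _ _)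
  rw [h0, hnull, zero_add] at hle
  exact hWpos.ne' (nonpos_iff_eq_zero.mp hle)

/-- **POSITIVE GIBBS MASS** of a measurable event of run `K` whose restricted unit density is a.e. positive on a window of positive
radius: `0 < Gibbs_K(S)` (the constrained unit law's total mass is `Gibbs_K(S)`). [cite: Balaban1985UV3, (2) p.256 and (7) p.257] -/
theorem gibbsK_pos_of_heightDensity_pos {S : Set (GaugeField (F.P K) 0 (Matrix.specialUnitaryGroup (Fin 2) ℂ))}
    (hS : MeasurableSet S) {δ : ℝ} (hδ : 0 < δ)
    (hpos : ∀ᵐ V ∂fieldMeasure (F.P 0) 0 (Matrix.specialUnitaryGroup (Fin 2) ℂ),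
      PlaqSmall δ V → 0 < heightDensity F γ (Nat.zero_le K) S V) :
    0 < gibbsK F ℰp γ K S := by
  have hw := map_unitA_restrict_window_pos F hγ K hS hδ hpos
  have hle : Measure.map (unitA F ℰp K) ((gibbsK F ℰp γ K).restrict S)
        {V : GaugeField (F.P 0) 0 (Matrix.specialUnitaryGroup (Fin 2) ℂ) | PlaqSmall δ V} ≤
      Measure.map (unitA F ℰp K) ((gibbsK F ℰp γ K).restrict S) Set.univ := measure_mono (Set.subset_univ _)
  rw [Measure.map_apply (measurable_unitA F ℰp measurableE_ℰp K) MeasurableSet.univ, Set.preimage_univ,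
    Measure.restrict_apply_univ] at hle
  exact hw.trans_le hle

end Mass

/-- **THE ALL-HEIGHTS UV-SMALL-HISTORY EVENTS HAVE POSITIVE GIBBS MASS** (small coupling): for every `L`, `(b₀ > 0, p₀ > 2)` there is
`0 < γ₁ ≤ 1` with `0 < Gibbs_K(histGood F ℰp θBal K 0)` for every family with `F.L = L`, every `0 < γ ≤ γ₁` and every run `K` — so the
constrained unit laws of the route's crux r2 are non-zero and a tilt between them has a positive constant.
[cite: Balaban1985UV3, (2) p.256 and (7) p.257] -/
theorem gibbsK_histGood_pos :
    ∀ (L : ℕ) (b₀ p₀ : ℝ), 0 < b₀ → 2 < p₀ → ∃ γ₁ : ℝ, 0 < γ₁ ∧ γ₁ ≤ 1 ∧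
      ∀ (F : T3Family) (γ : ℝ), F.L = L → 0 < γ → γ ≤ γ₁ → ∀ K : ℕ,
        0 < gibbsK F ℰp γ K (histGood F ℰp (θBal F.L γ b₀ p₀) K 0) := by
  intro L b₀ p₀ hb hp
  obtain ⟨γ₁, hγ₁, hγ₁1, H⟩ := heightDensity_histGood_pos_ae L b₀ p₀ hb hp
  refine ⟨γ₁, hγ₁, hγ₁1, fun F γ hFL hγ hγγ₁ K => ?_⟩
  have hL : 1 ≤ F.L := F.hL.2.le
  have hθ0 : 0 < θBal F.L γ b₀ p₀ 0 :=
    T3MinimiserStabilityReduction.θBal_pos hL hγ (hγγ₁.trans hγ₁1) hb p₀ 0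
  exact gibbsK_pos_of_heightDensity_pos F hγ.le K (measurableSet_histGood F ℰp measurableE_ℰp _ K 0) hθ0
    (H F γ hFL hγ hγγ₁ 0 K (Nat.zero_le K))

/-! ## §3 A tilt between `withDensity` measures IS an a.e. sandwich of the densities modulo a positive constant -/

section Converse

variable {X : Type*} [MeasurableSpace X]

/-- **TILT ⇒ A.E. SANDWICH** (pure measure theory; converse of the tree's `isTilt_withDensity_of_sandwich_ae`): if
`λ.withDensity ρ₁` is a tilt of radius `r` of `λ.withDensity ρ₀` (`λ` σ-finite, `ρ₀, ρ₁` measurable) and is NON-ZERO, then for some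
`c > 0`, a.e. `ofReal(c·e^{−r})·ρ₀ ≤ ρ₁ ≤ ofReal(c·e^{r})·ρ₀` (setwise domination `IsTilt.exists_smul_le_le_smul`, then
`ae_le_of_forall_setLIntegral_le_of_sigmaFinite`; the constant is positive because the zero constant forces the zero measure).
[cite: King1986, Thm 3.4 (3.9) p.656] -/
theorem ae_sandwich_of_isTilt_withDensity (lam : Measure X) [SigmaFinite lam] {ρ₀ ρ₁ : X → ℝ≥0∞}
    (h₀ : Measurable ρ₀) (h₁ : Measurable ρ₁) {r : ℝ}
    (ht : IsTilt (lam.withDensity ρ₀) (lam.withDensity ρ₁) r) (hne : lam.withDensity ρ₁ ≠ 0) :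
    ∃ c : ℝ, 0 < c ∧ ∀ᵐ x ∂lam,
      ENNReal.ofReal (c * Real.exp (-r)) * ρ₀ x ≤ ρ₁ x ∧ ρ₁ x ≤ ENNReal.ofReal (c * Real.exp r) * ρ₀ x := by
  obtain ⟨C, hC0, hlo, hhi⟩ := IsTilt.exists_smul_le_le_smul ht
  have hCpos : 0 < C := by
    rcases hC0.lt_or_eq with hC | hC
    · exact hC
    · exfalso
      apply hne
      rw [← hC, zero_mul, ENNReal.ofReal_zero, zero_smul] at hhi
      exact le_antisymm hhi (Measure.zero_le _)
  refine ⟨C, hCpos, ?_⟩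
  -- rewrite the scalar multiples as `withDensity` of scaled densities
  have hlo' : lam.withDensity (fun x => ENNReal.ofReal (C * Real.exp (-r)) * ρ₀ x) ≤ lam.withDensity ρ₁ := by
    have e : (fun x => ENNReal.ofReal (C * Real.exp (-r)) * ρ₀ x) = ENNReal.ofReal (C * Real.exp (-r)) • ρ₀ := by
      funext x; simp [Pi.smul_apply, smul_eq_mul]
    rw [e, withDensity_smul _ h₀]
    exact hlo
  have hhi' : lam.withDensity ρ₁ ≤ lam.withDensity (fun x => ENNReal.ofReal (C * Real.exp r) * ρ₀ x) := by
    have e : (fun x => ENNReal.ofReal (C * Real.exp r) * ρ₀ x) = ENNReal.ofReal (C * Real.exp r) • ρ₀ := by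
      funext x; simp [Pi.smul_apply, smul_eq_mul]
    rw [e, withDensity_smul _ h₀]
    exact hhi
  have hae_lo : (fun x => ENNReal.ofReal (C * Real.exp (-r)) * ρ₀ x) ≤ᵐ[lam] ρ₁ :=
    ae_le_of_forall_setLIntegral_le_of_sigmaFinite (h₀.const_mul _) fun s hs _ => by
      rw [← withDensity_apply _ hs, ← withDensity_apply _ hs]
      exact Measure.le_iff.mp hlo' s hs
  have hae_hi : ρ₁ ≤ᵐ[lam] fun x => ENNReal.ofReal (C * Real.exp r) * ρ₀ x :=
    ae_le_of_forall_setLIntegral_le_of_sigmaFinite h₁ fun s hs _ => by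
      rw [← withDensity_apply _ hs, ← withDensity_apply _ hs]
      exact Measure.le_iff.mp hhi' s hs
  filter_upwards [hae_lo, hae_hi] with x hx1 hx2
  exact ⟨hx1, hx2⟩

end Converse

section ConverseUnit

variable (F : T3Family) {γ : ℝ} (hγ : 0 ≤ γ) (K : ℕ)
  {S₀ : Set (GaugeField (F.P K) 0 (Matrix.specialUnitaryGroup (Fin 2) ℂ))}
  {S₁ : Set (GaugeField (F.P (K + 1)) 0 (Matrix.specialUnitaryGroup (Fin 2) ℂ))}

include hγ

/-- **THE UNIT-LATTICE TILT ⇒ THE A.E. SANDWICH OF THE RADON–NIKODYM DERIVATIVES** (converse of p588259's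
`isTilt_unitA_of_rnDeriv_sandwich_ae`): if `(A_{K+1})_*(Gibbs_{K+1}|S₁)` is a non-zero tilt of radius `r` of `(A_K)_*(Gibbs_K|S₀)`
(measurable events), then for some `c > 0` their Radon–Nikodym derivatives with respect to product Haar on the unit lattice satisfy
`ofReal(c·e^{−r})·ϱ_K ≤ ϱ_{K+1} ≤ ofReal(c·e^{r})·ϱ_K` a.e. [cite: King1986, Thm 3.4 (3.9) p.656] -/
theorem rnDeriv_sandwich_of_isTilt_unitA (hS₀ : MeasurableSet S₀) (hS₁ : MeasurableSet S₁) {r : ℝ}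
    (ht : IsTilt (Measure.map (unitA F ℰp K) ((gibbsK F ℰp γ K).restrict S₀))
      (Measure.map (unitA F ℰp (K + 1)) ((gibbsK F ℰp γ (K + 1)).restrict S₁)) r)
    (hne : Measure.map (unitA F ℰp (K + 1)) ((gibbsK F ℰp γ (K + 1)).restrict S₁) ≠ 0) :
    ∃ c : ℝ, 0 < c ∧ ∀ᵐ V ∂fieldMeasure (F.P 0) 0 (Matrix.specialUnitaryGroup (Fin 2) ℂ),
      ENNReal.ofReal (c * Real.exp (-r)) *
            (Measure.map (unitA F ℰp K) ((gibbsK F ℰp γ K).restrict S₀)).rnDeriv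
              (fieldMeasure (F.P 0) 0 (Matrix.specialUnitaryGroup (Fin 2) ℂ)) V ≤
          (Measure.map (unitA F ℰp (K + 1)) ((gibbsK F ℰp γ (K + 1)).restrict S₁)).rnDeriv
            (fieldMeasure (F.P 0) 0 (Matrix.specialUnitaryGroup (Fin 2) ℂ)) V ∧
        (Measure.map (unitA F ℰp (K + 1)) ((gibbsK F ℰp γ (K + 1)).restrict S₁)).rnDeriv
            (fieldMeasure (F.P 0) 0 (Matrix.specialUnitaryGroup (Fin 2) ℂ)) V ≤
          ENNReal.ofReal (c * Real.exp r) *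
            (Measure.map (unitA F ℰp K) ((gibbsK F ℰp γ K).restrict S₀)).rnDeriv
              (fieldMeasure (F.P 0) 0 (Matrix.specialUnitaryGroup (Fin 2) ℂ)) V := by
  haveI : IsProbabilityMeasure (fieldMeasure (F.P 0) 0 (Matrix.specialUnitaryGroup (Fin 2) ℂ)) :=
    Missing.isProbabilityMeasure_fieldMeasure (F.P 0) 0
  have hm₀ : Measurable fun V => ENNReal.ofReal
      ((partitionFn (G := Matrix.specialUnitaryGroup (Fin 2) ℂ) (F.P K) ((F.scheme ℰp γ).β K))⁻¹ *
        heightDensity F γ (Nat.zero_le K) S₀ V) :=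
    ((heightDensity_props F (Nat.zero_le K) hS₀ hγ).1.const_mul _).ennreal_ofReal
  have hm₁ : Measurable fun V => ENNReal.ofReal
      ((partitionFn (G := Matrix.specialUnitaryGroup (Fin 2) ℂ) (F.P (K + 1)) ((F.scheme ℰp γ).β (K + 1)))⁻¹ *
        heightDensity F γ (Nat.zero_le (K + 1)) S₁ V) :=
    ((heightDensity_props F (Nat.zero_le (K + 1)) hS₁ hγ).1.const_mul _).ennreal_ofReal
  rw [map_unitA_restrict_eq_withDensity F hγ K hS₀, map_unitA_restrict_eq_withDensity F hγ (K + 1) hS₁] at ht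
  rw [map_unitA_restrict_eq_withDensity F hγ (K + 1) hS₁] at hne
  obtain ⟨c, hc, hsw⟩ := ae_sandwich_of_isTilt_withDensity _ hm₀ hm₁ ht hne
  refine ⟨c, hc, ?_⟩
  filter_upwards [hsw, rnDeriv_map_unitA_restrict_ae_eq F hγ K hS₀,
    rnDeriv_map_unitA_restrict_ae_eq F hγ (K + 1) hS₁] with V hV h₀ h₁
  rw [h₀, h₁]
  exact hV

end ConverseUnit

/-! ## §4 The registered stub is EQUIVALENT to the crux -/

/-- **r2 `AllHeightsSmallTilt` ⇒ THE REGISTERED STUB `stub_smallDataSandwich` (spelled out)**: the all-heights unit tilts with summable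
radii give back, for small coupling, the a.e. two-sided sandwich of the constrained unit laws' Radon–Nikodym derivatives with positive
constants (§3, the laws being non-zero by §2).  With p588259's `allHeightsSmallTilt_of_smallDataSandwich` the stub is the crux in the
density currency. [cite: King1986, Thm 3.4 (3.9) p.656] -/
theorem smallDataSandwich_of_allHeightsSmallTilt
    (h : Summit.QuantumFields.YangMills.Theses.SmallFieldWidening.AllHeightsSmallTilt) :
    ∀ (L : ℕ) (b₀ p₀ : ℝ), 0 < b₀ → 2 < p₀ → ∃ γ₁ : ℝ, 0 < γ₁ ∧
      ∀ (F : T3Family) (γ : ℝ), F.L = L → 0 < γ → γ ≤ γ₁ → ∃ r : ℕ → ℝ, Summable r ∧ (∀ K, 0 ≤ r K) ∧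
        ∀ K : ℕ, ∃ c : ℝ, 0 < c ∧ ∀ᵐ V ∂(fieldMeasure (F.P 0) 0 (Matrix.specialUnitaryGroup (Fin 2) ℂ)),
          ENNReal.ofReal (c * Real.exp (-(r K))) *
                (Measure.map (unitA F ℰp K)
                    ((gibbsK F ℰp γ K).restrict (histGood F ℰp (θBal F.L γ b₀ p₀) K 0))).rnDeriv
                  (fieldMeasure (F.P 0) 0 (Matrix.specialUnitaryGroup (Fin 2) ℂ)) V ≤
              (Measure.map (unitA F ℰp (K + 1))
                  ((gibbsK F ℰp γ (K + 1)).restrict (histGood F ℰp (θBal F.L γ b₀ p₀) (K + 1) 0))).rnDeriv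
                (fieldMeasure (F.P 0) 0 (Matrix.specialUnitaryGroup (Fin 2) ℂ)) V ∧
            (Measure.map (unitA F ℰp (K + 1))
                  ((gibbsK F ℰp γ (K + 1)).restrict (histGood F ℰp (θBal F.L γ b₀ p₀) (K + 1) 0))).rnDeriv
                (fieldMeasure (F.P 0) 0 (Matrix.specialUnitaryGroup (Fin 2) ℂ)) V ≤
              ENNReal.ofReal (c * Real.exp (r K)) *
                (Measure.map (unitA F ℰp K)
                    ((gibbsK F ℰp γ K).restrict (histGood F ℰp (θBal F.L γ b₀ p₀) K 0))).rnDeriv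
                  (fieldMeasure (F.P 0) 0 (Matrix.specialUnitaryGroup (Fin 2) ℂ)) V := by
  intro L b₀ p₀ hb hp
  obtain ⟨γ₁, hγ₁, H⟩ := h L b₀ p₀ hb hp
  obtain ⟨γ₂, hγ₂, -, P⟩ := gibbsK_histGood_pos L b₀ p₀ hb hp
  refine ⟨min γ₁ γ₂, lt_min hγ₁ hγ₂, fun F γ hFL hγ hle => ?_⟩
  obtain ⟨r, hr, ht⟩ := H F γ hFL hγ (hle.trans (min_le_left _ _))
  refine ⟨r, hr, fun K => (ht K).nonneg, fun K => ?_⟩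
  have htK := ht K
  simp only [Nat.div_zero] at htK
  -- the run-`(K+1)` constrained unit law is non-zero: its total mass is `Gibbs_{K+1}(histGood (K+1) 0) > 0`
  have hmass := P F γ hFL hγ (hle.trans (min_le_right _ _)) (K + 1)
  have hne : Measure.map (unitA F ℰp (K + 1))
      ((gibbsK F ℰp γ (K + 1)).restrict (histGood F ℰp (θBal F.L γ b₀ p₀) (K + 1) 0)) ≠ 0 := by
    intro h0
    have huniv : Measure.map (unitA F ℰp (K + 1))
        ((gibbsK F ℰp γ (K + 1)).restrict (histGood F ℰp (θBal F.L γ b₀ p₀) (K + 1) 0)) Set.univ = 0 := by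
      rw [h0]; rfl
    rw [Measure.map_apply (measurable_unitA F ℰp measurableE_ℰp (K + 1)) MeasurableSet.univ, Set.preimage_univ,
      Measure.restrict_apply_univ] at huniv
    exact hmass.ne' huniv
  exact rnDeriv_sandwich_of_isTilt_unitA F hγ.le K
    (measurableSet_histGood F ℰp measurableE_ℰp (θBal F.L γ b₀ p₀) K 0)
    (measurableSet_histGood F ℰp measurableE_ℰp (θBal F.L γ b₀ p₀) (K + 1) 0) htK hne

/-- **THE REGISTERED STUB ⟺ THE CRUX r2** (`stub_smallDataSandwich` spelled out ↔ `AllHeightsSmallTilt`): p588259's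
`allHeightsSmallTilt_of_smallDataSandwich` and `smallDataSandwich_of_allHeightsSmallTilt`.  The BC3 skeleton of r2 therefore carries no
slack: its one stub is the crux in the density currency of [Balaban1985UV3] (41)/(47) at `m = 0`. [cite: King1986, Thm 3.4 (3.9) p.656] -/
theorem allHeightsSmallTilt_iff_smallDataSandwich :
    Summit.QuantumFields.YangMills.Theses.SmallFieldWidening.AllHeightsSmallTilt ↔
    ∀ (L : ℕ) (b₀ p₀ : ℝ), 0 < b₀ → 2 < p₀ → ∃ γ₁ : ℝ, 0 < γ₁ ∧
      ∀ (F : T3Family) (γ : ℝ), F.L = L → 0 < γ → γ ≤ γ₁ → ∃ r : ℕ → ℝ, Summable r ∧ (∀ K, 0 ≤ r K) ∧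
        ∀ K : ℕ, ∃ c : ℝ, 0 < c ∧ ∀ᵐ V ∂(fieldMeasure (F.P 0) 0 (Matrix.specialUnitaryGroup (Fin 2) ℂ)),
          ENNReal.ofReal (c * Real.exp (-(r K))) *
                (Measure.map (unitA F ℰp K)
                    ((gibbsK F ℰp γ K).restrict (histGood F ℰp (θBal F.L γ b₀ p₀) K 0))).rnDeriv
                  (fieldMeasure (F.P 0) 0 (Matrix.specialUnitaryGroup (Fin 2) ℂ)) V ≤
              (Measure.map (unitA F ℰp (K + 1))
                  ((gibbsK F ℰp γ (K + 1)).restrict (histGood F ℰp (θBal F.L γ b₀ p₀) (K + 1) 0))).rnDeriv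
                (fieldMeasure (F.P 0) 0 (Matrix.specialUnitaryGroup (Fin 2) ℂ)) V ∧
            (Measure.map (unitA F ℰp (K + 1))
                  ((gibbsK F ℰp γ (K + 1)).restrict (histGood F ℰp (θBal F.L γ b₀ p₀) (K + 1) 0))).rnDeriv
                (fieldMeasure (F.P 0) 0 (Matrix.specialUnitaryGroup (Fin 2) ℂ)) V ≤
              ENNReal.ofReal (c * Real.exp (r K)) *
                (Measure.map (unitA F ℰp K)
                    ((gibbsK F ℰp γ K).restrict (histGood F ℰp (θBal F.L γ b₀ p₀) K 0))).rnDeriv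
                  (fieldMeasure (F.P 0) 0 (Matrix.specialUnitaryGroup (Fin 2) ℂ)) V :=
  ⟨smallDataSandwich_of_allHeightsSmallTilt, allHeightsSmallTilt_of_smallDataSandwich⟩

end Summit.QuantumFields.YangMills.Theorems.AllHeightsSmallTilt

end
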